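import Literature.Combinatorics.Sahi2008.SetPartitionForm
import Literature.Combinatorics.Sahi2008.ProductOfChains
import Literature.Combinatorics.Sahi2008.PushForward
import Literature.Combinatorics.Sahi2008.Percolation
import HarnessLib

/-!
# Sahi positivity of every order for UNIONS OF TWO INDEPENDENT CHAINS (arc events of a cycle)

Support file for the Sahi programme (`--supports stmt-CriticalPhenomena-4575`, prover prim-sahi-p2 gen 8).
No named facts, no sorries; standard axioms.  Memo `run/shared/lean/prim/prim-sahi/prim-sahi-p2/PROOF-E3.md` §19.

**Setting.**  A finite type `α` with a probability weight `μ`, and two chains of events indexed by `Fin K`: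
`R k` shrinking in `k` ("right arcs": `k ≤ k' → R k' ⊆ R k`) and `L k` growing in `k` ("left arcs").
The events of interest are the UNIONS `A k = R k ∪ L k`.  Hypothesis: for `k ≤ k'` the complements
`(R k)ᶜ` and `(L k')ᶜ` are uncorrelated, `E[1_{(R k)ᶜ} 1_{(L k')ᶜ}] = E[1_{(R k)ᶜ}] E[1_{(L k')ᶜ}]`.

**Theorem `sahiE_nonneg_of_twoChainUnions`.**  Under these hypotheses Sahi's functional of EVERY order is
nonnegative on the events `A k`: for all `n` and all `κ : Fin n → Fin K`,
`0 ≤ E_n(1_{A (κ 0)}, …, 1_{A (κ (n-1))})`.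

The motivating instance (file `…IncStarCycle`): bond percolation on a cycle with arbitrary edge weights,
root `s`; the event `{s ↔ v}` is the union of "the clockwise arc from `s` to `v` is open" and "the
counter-clockwise arc is open"; the two arcs use disjoint edges exactly when the clockwise target is not
beyond the counter-clockwise one — the hypothesis above.  The joint law of the two arc lengths is NOT a
product law (nor FKG), so the two-dimensional theorem of Lieb–Sahi does not apply directly.

**Proof.**  (1) `E_n(f)` depends only on the product moments `E[∏_{i∈S} f_i]` (the set-partition form of
`E_n`, tree `sahiE_eq_sahiESetPartition`), hence — by the finite-difference recursion
`E[∏_T (1-f) · f_a ∏_S f] = E[∏_T(1-f) ∏_S f] − E[∏_{T+a}(1-f) ∏_S f]` — only on the AVOIDANCE moments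
`E[∏_{i∈S} (1 − f_i)]` (`sahiE_congr_of_complMoments`).  (2) For unions of two chains the avoidance moments
factor: `∏_{i∈S} 1_{(A κi)ᶜ} = 1_{(R κ_min)ᶜ} · 1_{(L κ_max)ᶜ}`, uncorrelated by hypothesis.  (3) The same
avoidance moments arise from the monotone functions `[κ i < r ∨ K − l ≤ κ i]` of `(r, l)` under the PRODUCT of
the laws of the two chain levels `r = #{k : x ∈ R k}`, `l = #{k : x ∈ L k}` on `Fin (K+1) × Fin (K+1)`,
where Sahi positivity of every order is the tree theorem `sahiPositive_prodWeight_linearOrder`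
(Lieb–Sahi 2022 Thm 3.7, discrete form, every product weight on a product of two chains).
-/

noncomputable section

namespace Summit.CriticalPhenomena.PercolationContinuityZ3.Theorems

namespace TwoChainUnions

open Finset Literature.Combinatorics.Sahi2008 Literature.Combinatorics.Sahi2008.PartitionForm
open Literature.Probability.Percolation.DecisionTree (ind ind_of_mem ind_of_not_mem ind_nonneg)
open scoped Classical

variable {α β : Type*} [Fintype α] [Fintype β]

/-! ### `E_n` sees only product moments, hence only avoidance moments -/

/-- **`E_n` depends only on the product moments** `E[∏_{i∈S} f_i]`, `S ⊆ {0,…,n-1}` (two weights on two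
types with the same product moments have the same `E_n`): immediate from the set-partition form
`E_n = Σ_π (−1)^{l(π)−1} Π_B (|B|−1)!·E(Π_{i∈B} f_i)`. [cite: Sahi2008, eqs. (4)–(7) (p. 211)] -/
theorem sahiE_congr_of_prodMoments (μ : α → ℝ) (μ' : β → ℝ) :
    ∀ (n : ℕ) (f : Fin n → α → ℝ) (f' : Fin n → β → ℝ),
      (∀ S : Finset (Fin n), ex μ (∏ i ∈ S, f i) = ex μ' (∏ i ∈ S, f' i)) →
      sahiE μ n f = sahiE μ' n f'
  | 0, f, f', _ => by rw [sahiE_zero, sahiE_zero]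
  | n + 1, f, f', h => by
    rw [sahiE_eq_sahiESetPartition, sahiE_eq_sahiESetPartition, sahiESetPartition_eq_sum_term,
      sahiESetPartition_eq_sum_term]
    refine sum_congr rfl fun c _ => ?_
    unfold term factor
    congr 1
    refine prod_congr rfl fun m _ => ?_
    rw [h (block c m)]

omit [Fintype β] in
/-- `E(f − g) = E(f) − E(g)` (plumbing). [folklore] -/
private theorem ex_sub' (μ : α → ℝ) (f g : α → ℝ) : ex μ (f - g) = ex μ f - ex μ g := by
  simp only [ex_def, Pi.sub_apply, mul_sub, Finset.sum_sub_distrib]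

omit [Fintype α] [Fintype β] in
/-- `∏_T(1−g)·∏_{S+a} g = ∏_T(1−g)∏_S g − ∏_{T+a}(1−g)∏_S g` (plumbing). [folklore] -/
private theorem prodCompl_mul_prod_insert {γ : Type*} {n : ℕ} (g : Fin n → γ → ℝ) {a : Fin n}
    {S T : Finset (Fin n)} (haS : a ∉ S) (haT : a ∉ T) :
    (∏ i ∈ T, (1 - g i)) * ∏ i ∈ insert a S, g i =
      (∏ i ∈ T, (1 - g i)) * ∏ i ∈ S, g i - (∏ i ∈ insert a T, (1 - g i)) * ∏ i ∈ S, g i := by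
  rw [prod_insert haS, prod_insert haT]
  ring

/-- The mixed moments `E[∏_{i∈T}(1 − f_i) · ∏_{i∈S} f_i]` (`S`, `T` disjoint) are determined by the avoidance
moments `E[∏_{i∈T}(1 − f_i)]`: finite-difference recursion in `S`. [this work] -/
theorem ex_prodCompl_mul_prod_congr (μ : α → ℝ) (μ' : β → ℝ) {n : ℕ} (f : Fin n → α → ℝ)
    (f' : Fin n → β → ℝ)
    (h : ∀ T : Finset (Fin n), ex μ (∏ i ∈ T, (1 - f i)) = ex μ' (∏ i ∈ T, (1 - f' i))) :
    ∀ (S T : Finset (Fin n)), Disjoint S T →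
      ex μ ((∏ i ∈ T, (1 - f i)) * ∏ i ∈ S, f i) =
        ex μ' ((∏ i ∈ T, (1 - f' i)) * ∏ i ∈ S, f' i) := by
  intro S
  induction S using Finset.induction_on with
  | empty =>
    intro T _
    simpa using h T
  | insert a S haS ih =>
    intro T hdisj
    have haT : a ∉ T := Finset.disjoint_left.1 hdisj (mem_insert_self a S)
    have hST : Disjoint S T := Finset.disjoint_of_subset_left (subset_insert a S) hdisj
    rw [prodCompl_mul_prod_insert f haS haT, prodCompl_mul_prod_insert f' haS haT, ex_sub', ex_sub',
      ih T hST, ih (insert a T) (Finset.disjoint_insert_right.2 ⟨haS, hST⟩)]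

/-- **`E_n` depends only on the avoidance moments** `E[∏_{i∈S}(1 − f_i)]`: two families (on two weighted
types) with the same avoidance moments have the same `E_n`. [this work] -/
theorem sahiE_congr_of_complMoments (μ : α → ℝ) (μ' : β → ℝ) {n : ℕ} (f : Fin n → α → ℝ)
    (f' : Fin n → β → ℝ)
    (h : ∀ T : Finset (Fin n), ex μ (∏ i ∈ T, (1 - f i)) = ex μ' (∏ i ∈ T, (1 - f' i))) :
    sahiE μ n f = sahiE μ' n f' := by
  refine sahiE_congr_of_prodMoments μ μ' n f f' fun S => ?_
  have := ex_prodCompl_mul_prod_congr μ μ' f f' h S ∅ (disjoint_empty_right S)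
  simpa using this

/-! ### Chain levels: a lower (upper) set of `Fin K` is an initial (final) segment -/

variable {K : ℕ}

omit [Fintype α] [Fintype β] in
/-- A down-closed subset `D` of `Fin K` is `{k : k < |D|}`. [folklore] -/
theorem mem_iff_lt_card_of_lower {D : Finset (Fin K)}
    (hD : ∀ ⦃k k' : Fin K⦄, k' ≤ k → k ∈ D → k' ∈ D) (k : Fin K) : k ∈ D ↔ k.val < D.card := by
  constructor
  · intro hk
    have hsub : Finset.Iic k ⊆ D := fun j hj => hD (Finset.mem_Iic.1 hj) hk
    have := Finset.card_le_card hsub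
    rw [Fin.card_Iic] at this
    omega
  · intro hlt
    by_contra hk
    have hsub : D ⊆ Finset.Iio k := fun j hj =>
      Finset.mem_Iio.2 (lt_of_not_ge fun hkj => hk (hD hkj hj))
    have := Finset.card_le_card hsub
    rw [Fin.card_Iio] at this
    omega

omit [Fintype α] [Fintype β] in
/-- An up-closed subset `U` of `Fin K` is `{k : K − |U| ≤ k}`. [folklore] -/
theorem mem_iff_sub_card_le_of_upper {U : Finset (Fin K)}
    (hU : ∀ ⦃k k' : Fin K⦄, k ≤ k' → k ∈ U → k' ∈ U) (k : Fin K) : k ∈ U ↔ K - U.card ≤ k.val := by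
  constructor
  · intro hk
    have hsub : Finset.Ici k ⊆ U := fun j hj => hU (Finset.mem_Ici.1 hj) hk
    have := Finset.card_le_card hsub
    rw [Fin.card_Ici] at this
    omega
  · intro hle
    by_contra hk
    have hsub : U ⊆ Finset.Ioi k := fun j hj =>
      Finset.mem_Ioi.2 (lt_of_not_ge fun hjk => hk (hU hjk hj))
    have := Finset.card_le_card hsub
    rw [Fin.card_Ioi] at this
    have := k.isLt
    omega

/-! ### Indicator plumbing -/

omit [Fintype α] [Fintype β] in
/-- `1 − 1_{R ∪ L} = 1_{Rᶜ} · 1_{Lᶜ}`. [folklore] -/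
theorem one_sub_ind_union (R L : Set α) : (1 : α → ℝ) - ind (R ∪ L) = ind Rᶜ * ind Lᶜ := by
  funext x
  simp only [Pi.sub_apply, Pi.one_apply, Pi.mul_apply]
  by_cases hR : x ∈ R
  · rw [ind_of_mem (Set.mem_union_left L hR), ind_of_not_mem (fun h => (Set.mem_compl_iff _ _).mp h hR)]; ring
  · by_cases hL : x ∈ L
    · rw [ind_of_mem (Set.mem_union_right R hL), ind_of_mem (show x ∈ Rᶜ from hR),
        ind_of_not_mem (fun h => (Set.mem_compl_iff _ _).mp h hL)]; ring
    · rw [ind_of_not_mem (by rintro (h | h) <;> contradiction), ind_of_mem (show x ∈ Rᶜ from hR),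
        ind_of_mem (show x ∈ Lᶜ from hL)]; ring

omit [Fintype α] [Fintype β] in
/-- A product of complement indicators over a family dominated by one of its members collapses to that member:
if `a ∈ T` and `A i ⊆ A a` for all `i ∈ T` then `∏_{i∈T} 1_{(A i)ᶜ} = 1_{(A a)ᶜ}`. [folklore] -/
theorem prod_ind_compl_eq_of_subset {ι : Type*} (T : Finset ι) (A : ι → Set α) {a : ι} (ha : a ∈ T)
    (hA : ∀ i ∈ T, A i ⊆ A a) : ∏ i ∈ T, ind (A i)ᶜ = ind (A a)ᶜ := by
  funext x
  rw [Finset.prod_apply]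
  by_cases hx : x ∈ A a
  · rw [ind_of_not_mem (show x ∉ (A a)ᶜ from fun h => (Set.mem_compl_iff _ _).mp h hx)]
    exact Finset.prod_eq_zero ha (ind_of_not_mem (show x ∉ (A a)ᶜ from fun h => (Set.mem_compl_iff _ _).mp h hx))
  · rw [ind_of_mem (show x ∈ (A a)ᶜ from hx)]
    exact Finset.prod_eq_one fun i hi => ind_of_mem (show x ∈ (A i)ᶜ from fun h => hx (hA i hi h))

omit [Fintype β] in
/-- `E` under a product weight of a product function factorises. [folklore] -/
theorem ex_prodWeight_mul {γ δ : Type*} [Fintype γ] [Fintype δ] (w₁ : γ → ℝ) (w₂ : δ → ℝ)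
    (F₁ : γ → ℝ) (F₂ : δ → ℝ) :
    ex (fun p : γ × δ => w₁ p.1 * w₂ p.2) (fun p => F₁ p.1 * F₂ p.2) = ex w₁ F₁ * ex w₂ F₂ := by
  rw [ex_def, ex_def, ex_def, Fintype.sum_prod_type, Finset.sum_mul_sum]
  refine Finset.sum_congr rfl fun r _ => Finset.sum_congr rfl fun l _ => ?_
  ring

/-! ### The theorem -/

/-- **Sahi positivity of every order for unions of two independent chains.**  Let `μ` be a probability weight on
the finite type `α`; let `R k` (`k : Fin K`) be a shrinking chain of events and `L k` a growing chain, such that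
for `k ≤ k'` the complements `(R k)ᶜ`, `(L k')ᶜ` are uncorrelated under `μ`.  Then for every `n` and every choice
`κ : Fin n → Fin K` of indices, Sahi's `E_n(1_{R κ₀ ∪ L κ₀}, …, 1_{R κ_{n-1} ∪ L κ_{n-1}}) ≥ 0`.
(Via avoidance moments and Lieb–Sahi's theorem for product weights on a product of two chains; the joint law of
the two chain levels need not be a product law.) [this work] -/
theorem sahiE_nonneg_of_twoChainUnions (μ : α → ℝ) (hμ0 : ∀ x, 0 ≤ μ x) (hμ1 : ∑ x, μ x = 1)
    (R L : Fin K → Set α)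
    (hR : ∀ ⦃k k' : Fin K⦄, k ≤ k' → R k' ⊆ R k) (hL : ∀ ⦃k k' : Fin K⦄, k ≤ k' → L k ⊆ L k')
    (hind : ∀ k k' : Fin K, k ≤ k' →
      ex μ (ind (R k)ᶜ * ind (L k')ᶜ) = ex μ (ind (R k)ᶜ) * ex μ (ind (L k')ᶜ))
    (n : ℕ) (κ : Fin n → Fin K) :
    0 ≤ sahiE μ n (fun i => ind (R (κ i) ∪ L (κ i))) := by
  -- the two chain levels
  let ρ : α → Fin (K + 1) := fun x =>
    ⟨(univ.filter fun k : Fin K => x ∈ R k).card,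
      Nat.lt_succ_of_le ((card_filter_le _ _).trans (by rw [Finset.card_fin]))⟩
  let lam : α → Fin (K + 1) := fun x =>
    ⟨(univ.filter fun k : Fin K => x ∈ L k).card,
      Nat.lt_succ_of_le ((card_filter_le _ _).trans (by rw [Finset.card_fin]))⟩
  have hρ : ∀ x (k : Fin K), x ∈ R k ↔ k.val < (ρ x).val := by
    intro x k
    have h := mem_iff_lt_card_of_lower (D := univ.filter fun k : Fin K => x ∈ R k)
      (fun k k' hkk' hk => by
        simp only [mem_filter, mem_univ, true_and] at hk ⊢
        exact hR hkk' hk) k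
    simpa only [mem_filter, mem_univ, true_and] using h
  have hlam : ∀ x (k : Fin K), x ∈ L k ↔ K - (lam x).val ≤ k.val := by
    intro x k
    have h := mem_iff_sub_card_le_of_upper (U := univ.filter fun k : Fin K => x ∈ L k)
      (fun k k' hkk' hk => by
        simp only [mem_filter, mem_univ, true_and] at hk ⊢
        exact hL hkk' hk) k
    simpa only [mem_filter, mem_univ, true_and] using h
  -- the model: product of the two level laws on `Fin (K+1) × Fin (K+1)`, monotone union indicators
  let w₁ : Fin (K + 1) → ℝ := pushWeight μ ρ
  let w₂ : Fin (K + 1) → ℝ := pushWeight μ lam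
  let W : Fin (K + 1) × Fin (K + 1) → ℝ := fun p => w₁ p.1 * w₂ p.2
  let G₁ : Fin K → Fin (K + 1) → ℝ := fun k r => if k.val < r.val then 0 else 1
  let G₂ : Fin K → Fin (K + 1) → ℝ := fun k l => if K - l.val ≤ k.val then 0 else 1
  let g : Fin K → Fin (K + 1) × Fin (K + 1) → ℝ := fun k p =>
    if k.val < p.1.val ∨ K - p.2.val ≤ k.val then 1 else 0
  have hpos : SahiPositive W n :=
    ProductChains.sahiPositive_prodWeight_linearOrder w₁ w₂ (pushWeight_nonneg hμ0 _)
      (by rw [sum_pushWeight, hμ1]) (pushWeight_nonneg hμ0 _) (by rw [sum_pushWeight, hμ1]) n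
  have hg0 : ∀ (i : Fin n) p, 0 ≤ g (κ i) p := by
    intro i p
    simp only [g]
    split_ifs <;> norm_num
  have hgm : ∀ i : Fin n, Monotone (g (κ i)) := by
    intro i p q hpq
    simp only [g]
    by_cases hp : (κ i).val < p.1.val ∨ K - p.2.val ≤ (κ i).val
    · have hq : (κ i).val < q.1.val ∨ K - q.2.val ≤ (κ i).val := by
        rcases hp with hp | hp
        · exact Or.inl (lt_of_lt_of_le hp (Fin.le_def.1 hpq.1))
        · refine Or.inr (le_trans ?_ hp)
          have := Fin.le_def.1 hpq.2
          omega
      rw [if_pos hp, if_pos hq]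
    · rw [if_neg hp]
      split_ifs <;> norm_num
  have hmodel : 0 ≤ sahiE W n (fun i => g (κ i)) := hpos _ hg0 hgm
  -- transfer along the avoidance moments
  rw [sahiE_congr_of_complMoments μ W (fun i => ind (R (κ i) ∪ L (κ i))) (fun i => g (κ i)) ?_]
  · exact hmodel
  intro T
  -- the two one-chain avoidance products
  set PR : α → ℝ := ∏ i ∈ T, ind (R (κ i))ᶜ with hPR
  set PL : α → ℝ := ∏ i ∈ T, ind (L (κ i))ᶜ with hPL
  -- (i) the real side is `E[PR · PL]`
  have hreal : (∏ i ∈ T, ((1 : α → ℝ) - ind (R (κ i) ∪ L (κ i)))) = PR * PL := by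
    rw [hPR, hPL, ← prod_mul_distrib]
    exact prod_congr rfl fun i _ => one_sub_ind_union _ _
  -- (ii) `E[PR · PL] = E[PR] E[PL]`
  have hfac : ex μ (PR * PL) = ex μ PR * ex μ PL := by
    rcases T.eq_empty_or_nonempty with hT | hT
    · have h1 : PR = 1 := by rw [hPR, hT, prod_empty]
      have h2 : PL = 1 := by rw [hPL, hT, prod_empty]
      rw [h1, h2, one_mul, ex_one hμ1, one_mul]
    · obtain ⟨a, ha, hamin⟩ := Finset.exists_min_image T κ hT
      obtain ⟨b, hb, hbmax⟩ := Finset.exists_max_image T κ hT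
      have hPRa : PR = ind (R (κ a))ᶜ :=
        prod_ind_compl_eq_of_subset T (fun i => R (κ i)) ha fun i hi => hR (hamin i hi)
      have hPLb : PL = ind (L (κ b))ᶜ :=
        prod_ind_compl_eq_of_subset T (fun i => L (κ i)) hb fun i hi => hL (hbmax i hi)
      rw [hPRa, hPLb]
      exact hind (κ a) (κ b) ((hamin b hb))
  -- (iii) the model side factorises as `E_μ[PR] E_μ[PL]`
  have hmodelprod : (∏ i ∈ T, ((1 : Fin (K + 1) × Fin (K + 1) → ℝ) - g (κ i))) =
      fun p => (∏ i ∈ T, G₁ (κ i) p.1) * (∏ i ∈ T, G₂ (κ i) p.2) := by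
    funext p
    rw [Finset.prod_apply, ← prod_mul_distrib]
    refine prod_congr rfl fun i _ => ?_
    simp only [Pi.sub_apply, Pi.one_apply, g, G₁, G₂]
    by_cases h1 : (κ i).val < p.1.val
    · simp [h1]
    · by_cases h2 : K - p.2.val ≤ (κ i).val
      · simp [h1, h2]
      · simp [h1, h2]
  have hG₁ : (fun x => ∏ i ∈ T, G₁ (κ i) (ρ x)) = PR := by
    funext x
    rw [hPR, Finset.prod_apply]
    refine prod_congr rfl fun i _ => ?_
    simp only [G₁]
    by_cases hx : x ∈ R (κ i)
    · rw [if_pos ((hρ x (κ i)).1 hx), ind_of_not_mem (show x ∉ (R (κ i))ᶜ from fun h => (Set.mem_compl_iff _ _).mp h hx)]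
    · rw [if_neg (fun h => hx ((hρ x (κ i)).2 h)), ind_of_mem (show x ∈ (R (κ i))ᶜ from hx)]
  have hG₂ : (fun x => ∏ i ∈ T, G₂ (κ i) (lam x)) = PL := by
    funext x
    rw [hPL, Finset.prod_apply]
    refine prod_congr rfl fun i _ => ?_
    simp only [G₂]
    by_cases hx : x ∈ L (κ i)
    · rw [if_pos ((hlam x (κ i)).1 hx), ind_of_not_mem (show x ∉ (L (κ i))ᶜ from fun h => (Set.mem_compl_iff _ _).mp h hx)]
    · rw [if_neg (fun h => hx ((hlam x (κ i)).2 h)), ind_of_mem (show x ∈ (L (κ i))ᶜ from hx)]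
  have hmodelex : ex W (∏ i ∈ T, ((1 : Fin (K + 1) × Fin (K + 1) → ℝ) - g (κ i))) =
      ex μ PR * ex μ PL := by
    rw [hmodelprod]
    rw [ex_prodWeight_mul w₁ w₂ (fun r => ∏ i ∈ T, G₁ (κ i) r) (fun l => ∏ i ∈ T, G₂ (κ i) l)]
    rw [show ex w₁ (fun r => ∏ i ∈ T, G₁ (κ i) r) = ex μ PR from by
        rw [show w₁ = pushWeight μ ρ from rfl, ex_pushWeight, ← hG₁]; rfl,
      show ex w₂ (fun l => ∏ i ∈ T, G₂ (κ i) l) = ex μ PL from by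
        rw [show w₂ = pushWeight μ lam from rfl, ex_pushWeight, ← hG₂]; rfl]
  rw [hreal, hfac, hmodelex]

end TwoChainUnions

end Summit.CriticalPhenomena.PercolationContinuityZ3.Theorems
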